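import Summits.KontsevichZagierPeriods.KontsevichZagierPeriods.Theses.WeightLine

/-!
# `BackwardVolterraRigidity` splits as (truncation constancy) + (truncation exhaustion)

Pure proof file, route `WeightLine`, supporting the rank-2 crux stmt-KontsevichZagierPeriods-7177
`BackwardVolterraRigidity` (BVR) with the typed decomposition filed by the crux strategist
(cstrat stmt-KontsevichZagierPeriods-7177, 2026-08-17).

Notation: `R_j : KZ.IntegralRep (d_j + 1)` total representations, level `s` = LAST coordinate,
`k_j ∈ ℤ`; for a rational level `t` the *upper truncation* is any presentation `T_j` with
`T_j.domain = R_j.domain ∩ {s > t}` and `T_j.integrand = R_j.integrand` on it, the *level band*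
`(a, b]` any `B_j` with `B_j.domain = R_j.domain ∩ {a < s ≤ b}`, the *slice* any `S_j` with
`S_j.domain = {x | (x, t) ∈ R_j.domain}`, `S_j.integrand = R_j.integrand (·, t)`; write
`D(t) = Σ k_j [T_j]`, `B(a,b] = Σ k_j [B_j]`, `G(t) = Σ k_j [S_j]` (classes in `KZ.FormalRep`).
BVR: if `G(t) + D(t) − c ∈ KZ.relations` for every rational `t > 0` (all presentations), then
`c ∈ KZ.relations` and `D(0) ∈ KZ.relations`.

The two pieces (their texts are the hypotheses `h₁`, `h₂` below, verbatim the route decls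
`UpperTruncationConstancy`, `TruncationExhaustion` filed by `route edit --split`):

* **UpperTruncationConstancy** (rigidity core): under the same hypothesis, `D(t) − c ∈ relations`
  for EVERY rational `t > 0` — the Volterra solution is constant modulo relations (at levels where
  the slices are presentable this is `G(t) ∈ relations`, "no semialgebraic Volterra eigenfamily").
* **TruncationExhaustion** (limit core): if every compactly supported level band `B(a,b]`,
  `t₀ < a < b` rational, is a relation, then `D(t₀)` is a relation (two-ended exhaustion of
  `{s > t₀}`; implied by the kernel form of Conjecture 1 through dominated convergence, no move of
  the calculus takes such a limit).

Assembly (`backwardVolterraRigidity_of_constancy_of_exhaustion`): constancy gives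
`D(a) − c, D(b) − c ∈ relations`; domain additivity `[R_j ∩ {s>a}] = [R_j ∩ {a<s≤b}] + [R_j ∩ {s>b}]`
(`KZ.domainAddRel`, disjoint pieces; stated for arbitrary presentations, so no separate
congruence step is needed) make every band `B(a,b]` with `0 < a < b` a relation;
exhaustion at `t₀ = 1` gives `D(1) ∈ relations`, hence `c ∈ relations`; exhaustion at `t₀ = 0`
gives `D(0) ∈ relations`. Only rule (1) of the calculus is used.

References: M. Kontsevich, D. Zagier, *Periods* (2001), §1.2 (rule (1)); route file
`Theses/WeightLine.lean` (card N2 'NSE', TWO-LAYER PLAN "TailRigidity (the +∞ end)").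
-/

noncomputable section

open MeasureTheory Set
open Literature.NumberTheory.Transcendental Literature.NumberTheory.Transcendental.KZ

namespace Summit.KontsevichZagierPeriods.WeightLine

/-- The open upper half-space `{z | t < z_last}` of `ℝ^{d+1}` at a rational level `t` is
`ℚ`-semialgebraic (`{C t < X_last}`). [cite: BochnakCosteRoy1998, Def. 2.1.4] -/
theorem isSemialgebraic_setOf_lt_last (d : ℕ) (t : ℚ) :
    Literature.ModelTheory.ExponentialFields.IsSemialgebraic ℚ
      {z : Fin (d + 1) → ℝ | (t : ℝ) < z (Fin.last d)} := by
  simpa [MvPolynomial.aeval_C, MvPolynomial.aeval_X] using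
    Literature.ModelTheory.ExponentialFields.isSemialgebraic_setOf_eval_lt (k := ℚ) (R := ℝ)
      (MvPolynomial.C t : MvPolynomial (Fin (d + 1)) ℚ) (MvPolynomial.X (Fin.last d))

/-- **Upper truncations are presentable**: `R ∩ {s > t}` is an integral representation with the
same integrand (restriction to a `ℚ`-semialgebraic subdomain, `KZ.IntegralRep.restrict`).
[cite: KontsevichZagier2001, §1.2] -/
theorem exists_upper_presentation {d : ℕ} (R : IntegralRep (d + 1)) (t : ℚ) :
    ∃ U : IntegralRep (d + 1),
      U.domain = R.domain ∩ {z | (t : ℝ) < z (Fin.last d)} ∧ U.integrand = R.integrand :=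
  ⟨R.restrict _ (R.isSemialgebraic_domain.inter (isSemialgebraic_setOf_lt_last d t))
      inter_subset_left, rfl, rfl⟩

/-- **Splitting an upper truncation at a higher level** (rule (1a), domain additivity): for
rational `a < b` and presentations `U` of `R ∩ {s > a}`, `B` of `R ∩ {a < s ≤ b}`, `U'` of
`R ∩ {s > b}`, the combination `[U] − [B] − [U']` is a relation (the two pieces are disjoint).
[cite: KontsevichZagier2001, §1.2 rule (1)] -/
theorem of_upper_sub_of_band_sub_of_upper_mem_relations {d : ℕ} (R U B U' : IntegralRep (d + 1))
    {a b : ℚ} (hab : a < b)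
    (hU : U.domain = R.domain ∩ {z | (a : ℝ) < z (Fin.last d)} ∧ EqOn U.integrand R.integrand U.domain)
    (hB : B.domain = R.domain ∩ {z | (a : ℝ) < z (Fin.last d) ∧ z (Fin.last d) ≤ (b : ℝ)} ∧
      EqOn B.integrand R.integrand B.domain)
    (hU' : U'.domain = R.domain ∩ {z | (b : ℝ) < z (Fin.last d)} ∧
      EqOn U'.integrand R.integrand U'.domain) :
    of U - of B - of U' ∈ relations := by
  have hab' : (a : ℝ) < b := by exact_mod_cast hab
  refine domainAddRel_subset_relations ⟨d + 1, U, B, U', ?_, ?_, ?_, ?_, rfl⟩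
  · rw [hU.1, hB.1, hU'.1]
    ext z
    simp only [mem_inter_iff, mem_setOf_eq, mem_union]
    constructor
    · rintro ⟨hz, hza⟩
      rcases le_or_gt (z (Fin.last d)) b with hzb | hzb
      · exact Or.inl ⟨hz, hza, hzb⟩
      · exact Or.inr ⟨hz, hzb⟩
    · rintro (⟨hz, hza, -⟩ | ⟨hz, hzb⟩)
      · exact ⟨hz, hza⟩
      · exact ⟨hz, hab'.trans hzb⟩
  · have : B.domain ∩ U'.domain = ∅ := by
      rw [hB.1, hU'.1]
      ext z
      simp only [mem_inter_iff, mem_setOf_eq, mem_empty_iff_false, iff_false]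
      exact fun h => (not_lt.mpr h.1.2.2) h.2.2
    rw [this, measure_empty]
  · intro z hz
    have hzU : z ∈ U.domain := by
      rw [hU.1]; rw [hB.1] at hz
      exact ⟨hz.1, hz.2.1⟩
    rw [hU.2 hzU, hB.2 hz]
  · intro z hz
    have hzU : z ∈ U.domain := by
      rw [hU.1]; rw [hU'.1] at hz
      exact ⟨hz.1, hab'.trans hz.2⟩
    rw [hU.2 hzU, hU'.2 hz]

/-- `ℤ`-combinations of relations are relations. [folklore] -/
theorem sum_zsmul_mem_relations {J : ℕ} (k : Fin J → ℤ) (x : Fin J → FormalRep)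
    (hx : ∀ j, x j ∈ relations) : ∑ j, k j • x j ∈ relations :=
  relations.sum_mem fun j _ => relations.zsmul_mem (hx j) (k j)

/-- **`BackwardVolterraRigidity` from its two pieces.** Hypothesis `h₁` is the route decl
`UpperTruncationConstancy` (every upper truncation `D(t)`, `t > 0` rational, is congruent to `c`
under the backward Volterra relations) and `h₂` is the route decl `TruncationExhaustion`
(two-ended exhaustion of an upper truncation by compactly supported level bands), both verbatim.
Proof: (i) `h₁` at levels `a < b` plus domain additivity
(`of_upper_sub_of_band_sub_of_upper_mem_relations`, for arbitrary presentations) make every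
level band `B(a,b]` with `0 < a < b` a relation; (ii) `h₂` at `t₀ = 1` then makes `D(1)` a
relation, so `c ≡ D(1) ≡ 0`; (iii) `h₂` at `t₀ = 0` makes `D(0)` a relation. Uses rule (1) of
the calculus only. [cite: KontsevichZagier2001, §1.2 rule (1)] -/
theorem backwardVolterraRigidity_of_constancy_of_exhaustion
    (h₁ : ∀ (J : ℕ) (d : Fin J → ℕ) (k : Fin J → ℤ) (R : (j : Fin J) → Literature.NumberTheory.Transcendental.KZ.IntegralRep (d j + 1)) (c : Literature.NumberTheory.Transcendental.KZ.FormalRep), (∀ t : ℚ, 0 < (t : ℝ) → ∀ (S : (j : Fin J) → Literature.NumberTheory.Transcendental.KZ.IntegralRep (d j)) (T : (j : Fin J) → Literature.NumberTheory.Transcendental.KZ.IntegralRep (d j + 1)), (∀ j, (S j).domain = {x | Fin.snoc x (t : ℝ) ∈ (R j).domain} ∧ Set.EqOn (S j).integrand (fun x => (R j).integrand (Fin.snoc x (t : ℝ))) (S j).domain ∧ (T j).domain = (R j).domain ∩ {z | (t : ℝ) < z (Fin.last (d j))} ∧ Set.EqOn (T j).integrand (R j).integrand (T j).domain) → ∑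 j, k j • (Literature.NumberTheory.Transcendental.KZ.of (S j) + Literature.NumberTheory.Transcendental.KZ.of (T j)) - c ∈ Literature.NumberTheory.Transcendental.KZ.relations) → ∀ t : ℚ, 0 < (t : ℝ) → ∀ (T : (j : Fin J) → Literature.NumberTheory.Transcendental.KZ.IntegralRep (d j + 1)), (∀ j, (T j).domain = (R j).domain ∩ {z | (t : ℝ) < z (Fin.last (d j))} ∧ Set.EqOn (T j).integrand (R j).integrand (T j).domain) → ∑ j, k j • Literature.NumberTheory.Transcendental.KZ.of (T j) - c ∈ Literature.NumberTheory.Transcendental.KZ.relations)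
    (h₂ : ∀ (J : ℕ) (d : Fin J → ℕ) (k : Fin J → ℤ) (R : (j : Fin J) → Literature.NumberTheory.Transcendental.KZ.IntegralRep (d j + 1)) (t₀ : ℚ), (∀ a b : ℚ, t₀ < a → a < b → ∀ (B : (j : Fin J) → Literature.NumberTheory.Transcendental.KZ.IntegralRep (d j + 1)), (∀ j, (B j).domain = (R j).domain ∩ {z | (a : ℝ) < z (Fin.last (d j)) ∧ z (Fin.last (d j)) ≤ (b : ℝ)} ∧ Set.EqOn (B j).integrand (R j).integrand (B j).domain) → ∑ j, k j • Literature.NumberTheory.Transcendental.KZ.of (B j) ∈ Literature.NumberTheory.Transcendental.KZ.relations) → ∀ (T : (j : Fin J) → Literature.NumberTheory.Transcendental.KZ.IntegralRep (d j + 1)), (∀ j, (T j).domain = (R j).domain ∩ {z | (t₀ : ℝ) < z (Fin.last (d j))} ∧ Set.EqOn (T j).integrand (R j).integrand (T j).domain) → ∑ j, k j • Literature.NumberTheory.Transcendental.KZ.of (T j) ∈ Literature.NumberTheory.Transcendental.KZ.relations) :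
    Summit.KontsevichZagierPeriods.KontsevichZagierPeriods.Theses.WeightLine.BackwardVolterraRigidity := by
  intro J d k R c hH
  -- (0) constancy: every upper truncation at a positive rational level is congruent to `c`
  have hD : ∀ t : ℚ, 0 < (t : ℝ) → ∀ (T : (j : Fin J) → IntegralRep (d j + 1)),
      (∀ j, (T j).domain = (R j).domain ∩ {z | (t : ℝ) < z (Fin.last (d j))} ∧
        EqOn (T j).integrand (R j).integrand (T j).domain) →
      ∑ j, k j • of (T j) - c ∈ relations := h₁ J d k R c hH
  -- (i) every level band between positive rational levels is a relation
  have hBand : ∀ a b : ℚ, 0 < (a : ℝ) → a < b → ∀ (B : (j : Fin J) → IntegralRep (d j + 1)),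
      (∀ j, (B j).domain = (R j).domain ∩ {z | (a : ℝ) < z (Fin.last (d j)) ∧ z (Fin.last (d j)) ≤ (b : ℝ)} ∧
        EqOn (B j).integrand (R j).integrand (B j).domain) →
      ∑ j, k j • of (B j) ∈ relations := by
    intro a b ha hab B hB
    have hb : 0 < (b : ℝ) := ha.trans (by exact_mod_cast hab)
    choose U hUd hUi using fun j => exists_upper_presentation (R j) a
    choose U' hU'd hU'i using fun j => exists_upper_presentation (R j) b
    have hUp : ∀ j, (U j).domain = (R j).domain ∩ {z | (a : ℝ) < z (Fin.last (d j))} ∧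
        EqOn (U j).integrand (R j).integrand (U j).domain :=
      fun j => ⟨hUd j, fun z _ => congrFun (hUi j) z⟩
    have hU'p : ∀ j, (U' j).domain = (R j).domain ∩ {z | (b : ℝ) < z (Fin.last (d j))} ∧
        EqOn (U' j).integrand (R j).integrand (U' j).domain :=
      fun j => ⟨hU'd j, fun z _ => congrFun (hU'i j) z⟩
    have hDa : ∑ j, k j • of (U j) - c ∈ relations := hD a ha U hUp
    have hDb : ∑ j, k j • of (U' j) - c ∈ relations := hD b hb U' hU'p
    have hsplit : ∑ j, k j • (of (U j) - of (B j) - of (U' j)) ∈ relations :=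
      sum_zsmul_mem_relations k _ fun j =>
        of_upper_sub_of_band_sub_of_upper_mem_relations (R j) (U j) (B j) (U' j) hab
          (hUp j) (hB j) (hU'p j)
    have key : ∑ j, k j • of (B j) =
        (∑ j, k j • of (U j) - c) - (∑ j, k j • of (U' j) - c) -
          ∑ j, k j • (of (U j) - of (B j) - of (U' j)) := by
      simp only [smul_sub, Finset.sum_sub_distrib]
      abel
    rw [key]
    exact relations.sub_mem (relations.sub_mem hDa hDb) hsplit
  -- (ii) the jump: exhaustion at level 1 makes `D(1)` a relation, hence `c`
  have hc : c ∈ relations := by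
    choose U hUd hUi using fun j => exists_upper_presentation (R j) 1
    have hUp : ∀ j, (U j).domain = (R j).domain ∩ {z | ((1 : ℚ) : ℝ) < z (Fin.last (d j))} ∧
        EqOn (U j).integrand (R j).integrand (U j).domain :=
      fun j => ⟨hUd j, fun z _ => congrFun (hUi j) z⟩
    have hU0 : ∑ j, k j • of (U j) ∈ relations :=
      h₂ J d k R 1 (fun a b h1a hab B hB =>
        hBand a b (by exact_mod_cast (zero_lt_one.trans h1a)) hab B hB) U hUp
    have hU1 : ∑ j, k j • of (U j) - c ∈ relations := hD 1 (by norm_num) U hUp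
    have key : c = ∑ j, k j • of (U j) - (∑ j, k j • of (U j) - c) := by abel
    rw [key]
    exact relations.sub_mem hU0 hU1
  refine ⟨hc, fun T₀ hT₀ => ?_⟩
  -- (iii) the truncation at level 0: exhaustion at level 0
  refine h₂ J d k R 0 (fun a b h0a hab B hB => hBand a b (by exact_mod_cast h0a) hab B hB) T₀ ?_
  intro j
  obtain ⟨h1, h2⟩ := hT₀ j
  exact ⟨by simpa using h1, h2⟩

end Summit.KontsevichZagierPeriods.WeightLine

end
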